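import Literature.MathematicalPhysics.QuantumFieldTheory.Balaban1983to89.B5QGGQ145Bounds
import Literature.MathematicalPhysics.QuantumFieldTheory.Balaban1983to89.B4Torus248Decay

/-!
# `Balaban1983to89.B5QGGQ145Factor` — the Gram factorisation `Q′_kG′_k²Q′_k^* = (Q′_kG′_k)·(G′_kQ′_k^*)` AS A
# PRODUCT OF REAL MATRICES on the finite torus, in the shape `B * G * G * Bst` (with `G := 1`) consumed by the cell's
# (1.126) engine `B5Decay126.decay126_torus`; the factor `G′Q′^*` is real, and its entries decay (b04, by name)

T. Bałaban, *Propagators and renormalization transformations for lattice gauge theories. I*, Commun. Math. Phys.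
**95**, 17–40 (1984) [Balaban1984PropagatorsI] (cell paper B5): p. 25 [PDF 9] ((1.44) and the positivity sentence)
and p. 38 [PDF 22] (the (1.126) sentence); [2] = B4 = [Balaban1983RegularityDecay], Lemma 2.4.  Renders
`1984-cmp95-propagators-rt-I-p009-x2.png`, `-p022-x2.png` (cell folder `b2b-balaban-ref1/pages/`) read as images by
this seat's lineage (b05).

CITATION HEADER (lean-in-tree rule 2026-08-18).  PRINTED, p. 25, verbatim: *"R = I − G′_kQ′_k^*(Q′_kG′_k²Q′_k^*)^{−1}Q′_kG′_k.
(1.44)  Now all the operators appearing in these formulas are well defined. We have to verify it only for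
(Q′_kG′_k²Q′_k^*)^{−1}. It is enough to prove that Q′_kG′_k²Q′_k^* is positive definite. This operator is of course
nonnegative and if for some ω defined on T₁^{(k)} we have ⟨ω, Q′_kG′_k²Q′_k^*ω⟩ = ‖G′_kQ′_k^*ω‖² = 0, then Q′_k^*ω = 0,
hence ω = 0."*  P. 38, verbatim: *"Let us write bounds for the operator ∂P∂^*. They follow from the representation
P = G′Q′^*(Q′G′²Q′^*)^{−1}Q′G′, from Lemma 2.4 of [2], and the representation (1.45) and the analyticity method of proving
an exponential decay (see the proof of Lemma 2.4 in [2]). We obtain |(∂P∂^*)_{μ,ν}(x, x′)| ≦ O(1)e^{−δ′₀|x−x′|}, (1.126)"*.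

WHAT THE CELL ALREADY HAS (imported, untouched).  b05-g7: `B5QGGQ145Torus.qggq` (the matrix of `Q′G′²Q′^*` on the unit
torus, defined as the Gram kernel `ξ^{d+1}Σ_{z∈T_ξ} \overline{K_T(z,y)}K_T(z,y′)` of b04's `K_T(·,y) = G′Q′^*δ_y` and
PROVED to be the operator product, `qggq_eq_blockAvg`), `B5QGGQ145Torus.GQ` (`ω ↦ G′Q′^*ω`), `gram_qggq`;
`B5QGGQ145Bounds.conj_KT` (`K_T` real), the coarse index `Idx N = Π_μ Fin N_μ` with representatives `toZ`,
`sum_box_eq_sum_idx`, `extR`, the real matrix `qggqRe n a N` with `coercive_qggqRe` (`QGQInverse.Coercive (qggqRe n a N) γ₀`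
uniformly in `n ≥ 1`, `a ∈ [a₋,a₊]`, `N`) and `qggqRe_inv` (`(qggqRe)⁻¹ = kerRe`).  b04: `K_T n a m2 N z y =
torusKernel248 n a m2 (offset z) N (coarse z − y)` and its volume-uniform decay
`B4Torus248Decay.kernel248_torusKernel_decay_torusMetric` (B4 Lemma 2.4 on the torus, sup-metric `MultiPeriod.torusSupNorm`
of the unit torus).  pv15: the (1.126) engine `B5Decay126.decay126_torus`, whose inputs are real matrices `D, D′, G : ι×ι`,
`B : κ×ι`, `Bst : ι×κ` with `PosDecay` hypotheses and `hM : QGQInverse.Coercive (B * G * G * Bst) γ₀`, concluding the decay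
of `D·G·Bst·(B·G·G·Bst)⁻¹·B·G·D′` (= `∂P∂^*`).  LOCATED GAP (cell census G-B5-36 (iii′)): the coercive matrix of
`B5QGGQ145Bounds` is the ASSEMBLED product on the coarse index, while the engine wants it AS a product of positioned
factor matrices — the factor dictionary was untyped, and it was open whether a separate matrix for `G′` (a fine torus
Green function with delta data, absent from the tree) is needed.

THIS FILE (journal node QGGQ-145-FACTOR of the cell `pub-balaban`, unit b2b-balaban-b05-g7) settles the dictionary in
the `G := 1` FACTORISATION, sorry-free — `G′` never occurs alone in `P = G′Q′^*(Q′G′²Q′^*)^{−1}Q′G′`, only inside the two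
factors `G′Q′^*` and `Q′G′`, so NO fine Green matrix is needed:
* §1 **`KRe n a N : Matrix (Idx (n·N)) (Idx N) ℝ`**, entry `Re K_T(toZ z, toZ k)` — the factor `G′_kQ′_k^*` as a real
  matrix (fine × coarse); `KT_im` / `KRe_coe` (the entry IS `K_T`), **`KRe_mulVec`** (`KRe x = Re G′Q′^*(extR x)`: it is
  the matrix of `B5QGGQ145Torus.GQ`);
* §2 **`QGRe n a N := ξ^{d+1}·KReᵀ`** — the factor `Q′_kG′_k` (coarse × fine; the adjoint for the pairings `Σ_y` on `T₁`,
  `ξ^{d+1}Σ_z` on `T_ξ`), `QGRe_apply`;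
* §3 **`QGRe_mul_KRe`**: `QGRe · KRe = qggqRe` — the printed `⟨ω,Q′G′²Q′^*ω⟩ = ‖G′Q′^*ω‖²` as the matrix identity
  `(Q′G′)(G′Q′^*) = Q′G′²Q′^*`; **`QGRe_one_one_KRe`**: `QGRe · 1 · 1 · KRe = qggqRe` (the literal shape `B * G * G * Bst`);
  **`coercive_factorised`**: `∃ γ₀ > 0, ∀ n ≥ 1, ∀ a ∈ [a₋,a₊], ∀ N (N_μ ≥ 1), QGQInverse.Coercive (QGRe * 1 * 1 * KRe) γ₀`
  — hypothesis `hM` of `decay126_torus` DISCHARGED in the multiplier model with `B := QGRe`, `G := 1`, `Bst := KRe`;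
  `inv_factorised`: `(QGRe·1·1·KRe)⁻¹ = kerRe` (`= Re torusKernel145M`, pv17's kernel);
* §4 **`KRe_decay`** / `abs_QGRe_le` / **`QGRe_decay`**: the entries of both factors decay, uniformly in `n`, `a ∈ [a₋,a₊]`
  and the volume — b04's `kernel248_torusKernel_decay_torusMetric` at `m² = 0`, BY NAME, in b04's unit-torus sup-metric:
  `|KRe(z,k)|, |QGRe(k,z)| ≤ M·periodConst κ d·exp(−(κ/(d+1))·torusSupNorm N (coarse z − k))`.

DICTIONARY / HONEST SCOPE.  As in `B5QGGQ145Torus`/`Bounds` (ξ-units, `n = L^k = ξ⁻¹ ≥ 1`, `m² = 0`, unit torus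
`Π_μ ℤ/N_μ` with a period vector, scalar fields `U = 1`).  Index sets carry COUNTING measure: the operator `Q′G′` for the
weighted pairings has matrix `ξ^{d+1}K_Tᵀ` (the weight `ξ^{d+1}` of `⟨·,·⟩_ξ` is put on the coarse-side factor; any split
`ξ^{s}Kᵀ · ξ^{d+1−s}K` would do — the engine only sees the product and the two decays).  `G := 1`: pv15's engine keeps
an abstract `G` between the factors; here it is the identity matrix on the fine index (whose `PosDecay` is immediate for
any pseudo-distance with `dX x x = 0`), the Green operator living inside `KRe`/`QGRe`; consequently the engine's `D·G·Bst`
reads `∂·(G′Q′^*)` and `B·G·D′` reads `(Q′G′)·∂^*`, which IS the printed `∂P∂^*` grouping.  NOT typed here (cell census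
G-B5-37): (a) the POSITIONING of the two index sets in pv15's carrier `B5TorusCover.UT N′` (`N′ = n·N` the fine periods;
`πf = id` on `Idx (n·N) = TSite (d+1) (n·N)`, `σ k =` the block corner `n·k`) and the conversion of b04's coarse sup-metric
bound `exp(−(κ/(d+1))·torusSupNorm N (coarse z − k))` into pv15's `PosDecay (dist on UT N′) …` with rate `≈ κ/((d+1)n)`
in fine units (pure metric arithmetic: `tdist_{nN}(z, nk) ≤ n·torusSupNorm N (coarse z − k) + n`); (b) the matrices
`D, D′` (the derivative `∂` and its adjoint, finite range) and their `PosDecay`; (c) the final call of `decay126_torus` /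
`h128_of_constituents` with `hM := coercive_factorised` — after (a)(b) NO coercivity and NO Green-function hypothesis is
left in the torus-model (1.126)/(1.128) leaf; (d) `η`-rescaling, gauge fields `U ≠ 1`.  Value = kernel certificate of a
printed identity (the Gram form of `Q′G′²Q′^*`) as a factorisation of real matrices in the consumer's shape + the design
decision `G := 1` for the (1.126) instantiation, NOT summit progress.  Staged byte-identically under `HOME/lean/BalabanYm4/`.

Tags: 5 `[cite: …]` (`KRe`, `QGRe`, `QGRe_mul_KRe`, `coercive_factorised`, `KRe_decay`: the two factor objects and the
statements that ARE printed identities / the printed inputs of (1.126)), 8 `[folklore]`.  No `sorry`, no new axioms;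
imports `B5QGGQ145Bounds` (b05-g7) and `B4Torus248Decay` (b04) only.
-/

namespace Literature.MathematicalPhysics.QuantumFieldTheory.Balaban1983to89.B5QGGQ145Factor

open Complex Finset ComplexConjugate UnitAddTorus
open Literature.MathematicalPhysics.QuantumFieldTheory.Balaban1983to89.B4Strip
open Literature.MathematicalPhysics.QuantumFieldTheory.Balaban1983to89.B4TorusKernel
open Literature.MathematicalPhysics.QuantumFieldTheory.Balaban1983to89.B4Torus248Decay
open Literature.MathematicalPhysics.QuantumFieldTheory.Balaban1983to89.B4Green244
open Literature.MathematicalPhysics.QuantumFieldTheory.Balaban1983to89.B4TorusGreen244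
open Literature.MathematicalPhysics.QuantumFieldTheory.Balaban1983to89.B4TorusPositivity
open Literature.MathematicalPhysics.QuantumFieldTheory.Balaban1983to89.B5QGGQ145Torus
open Literature.MathematicalPhysics.QuantumFieldTheory.Balaban1983to89.B5QGGQ145Bounds
open scoped Real Matrix

noncomputable section

variable {d : ℕ}

/-! ### §1 The factor `G′_kQ′_k^*` as a REAL matrix (fine index × coarse index) -/

/-- `K_T` has zero imaginary part (`B5QGGQ145Bounds.conj_KT`). [folklore] -/
theorem KT_im (n : ℕ) [NeZero n] (hn1 : 1 ≤ n) (a m2 : ℝ) (ha : 0 < a) (hm : 0 ≤ m2) {N : Fin (d + 1) → ℕ}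
    (hN : ∀ i, 1 ≤ N i) (z y : Fin (d + 1) → ℤ) : (KT n a m2 N z y).im = 0 :=
  Complex.conj_eq_iff_im.mp (conj_KT n hn1 a m2 ha hm hN z y)

/-- **THE FACTOR `G′_kQ′_k^*` AS A REAL MATRIX**: rows = the fine torus `Π_μ Fin (nN_μ)` (sites of `T_ξ`), columns = the
unit torus `Π_μ Fin N_μ`; entry `Re K_T(z,y)` (`K_T(·,y) = G′Q′^*δ_y`, real).  With counting measure on both index sets
this IS the matrix of `ω ↦ G′_kQ′_k^*ω` (`KRe_mulVec`). [cite: Balaban1984PropagatorsI, (1.44) p.25 (the factor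
`G′_kQ′_k^*` of `R = I − G′_kQ′_k^*(Q′_kG′_k²Q′_k^*)^{−1}Q′_kG′_k`)] -/
def KRe (n : ℕ) [NeZero n] (a : ℝ) (N : Fin (d + 1) → ℕ) : Matrix (Idx (fun i => n * N i)) (Idx N) ℝ :=
  Matrix.of fun z k => (KT n a 0 N (toZ z) (toZ k)).re

/-- the real entry IS the complex kernel `K_T`. [folklore] -/
theorem KRe_coe (n : ℕ) [NeZero n] (hn1 : 1 ≤ n) (a : ℝ) (ha : 0 < a) {N : Fin (d + 1) → ℕ} (hN : ∀ i, 1 ≤ N i)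
    (z : Idx (fun i => n * N i)) (k : Idx N) : ((KRe n a N z k : ℝ) : ℂ) = KT n a 0 N (toZ z) (toZ k) := by
  apply Complex.ext
  · simp only [KRe, Matrix.of_apply, Complex.ofReal_re]
  · rw [Complex.ofReal_im, KT_im n hn1 a 0 ha le_rfl hN]

/-- **`KRe` IS THE MATRIX OF `ω ↦ G′Q′^*ω`**: on a real vector `x` on the unit torus,
`(KRe x)(z) = Re (G′Q′^*(extR x))(z)` (`B5QGGQ145Torus.GQ`). [folklore] -/
theorem KRe_mulVec (n : ℕ) [NeZero n] (a : ℝ) (N : Fin (d + 1) → ℕ) (x : Idx N → ℝ)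
    (z : Idx (fun i => n * N i)) : (KRe n a N *ᵥ x) z = (GQ n a 0 N (extR x) (toZ z)).re := by
  unfold GQ
  rw [sum_box_eq_sum_idx N, Complex.re_sum]
  simp only [Matrix.mulVec, dotProduct, KRe, Matrix.of_apply, extR_toZ, Complex.re_ofReal_mul]
  exact Finset.sum_congr rfl fun k _ => mul_comm _ _

/-! ### §2 The factor `Q′_kG′_k` as a REAL matrix (coarse index × fine index): `ξ^{d+1}·(G′Q′^*)ᵀ` -/

/-- **THE FACTOR `Q′_kG′_k` AS A REAL MATRIX**: `ξ^{d+1}·KReᵀ` — the adjoint of `G′Q′^*` for the pairings `Σ_y` on `T₁`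
and `ξ^{d+1}Σ_z` on `T_ξ` (`G′` symmetric, `K_T` real), written for counting measure on both sides.
[cite: Balaban1984PropagatorsI, (1.44) p.25 (the factor `Q′_kG′_k`)] -/
def QGRe (n : ℕ) [NeZero n] (a : ℝ) (N : Fin (d + 1) → ℕ) : Matrix (Idx N) (Idx (fun i => n * N i)) ℝ :=
  ((n : ℝ) ^ (d + 1))⁻¹ • (KRe n a N)ᵀ

/-- the entries of `QGRe`. [folklore] -/
theorem QGRe_apply (n : ℕ) [NeZero n] (a : ℝ) (N : Fin (d + 1) → ℕ) (k : Idx N) (z : Idx (fun i => n * N i)) :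
    QGRe n a N k z = ((n : ℝ) ^ (d + 1))⁻¹ * KRe n a N z k := by
  simp only [QGRe, Matrix.smul_apply, Matrix.transpose_apply, smul_eq_mul]

/-! ### §3 The Gram factorisation `Q′G′²Q′^* = (Q′G′)·(G′Q′^*)` as a product of real matrices -/

/-- **THE GRAM FACTORISATION**: `QGRe · KRe = qggqRe`, i.e. `(Q′_kG′_k)·(G′_kQ′_k^*) = Q′_kG′_k²Q′_k^*` as real matrices on
the unit torus — entrywise `ξ^{d+1} Σ_{z∈T_ξ} K_T(z,y) K_T(z,y′) = (Q′G′²Q′^*)(y,y′)`, the definition of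
`B5QGGQ145Torus.qggq` with `K_T` real. [cite: Balaban1984PropagatorsI, p.25 ("⟨ω, Q′_kG′_k²Q′_k^*ω⟩ = ‖G′_kQ′_k^*ω‖²")] -/
theorem QGRe_mul_KRe (n : ℕ) [NeZero n] (hn1 : 1 ≤ n) (a : ℝ) (ha : 0 < a) {N : Fin (d + 1) → ℕ}
    (hN : ∀ i, 1 ≤ N i) : QGRe n a N * KRe n a N = qggqRe n a N := by
  ext k k'
  have hc : ((n : ℂ) ^ (d + 1))⁻¹ = ((((n : ℝ) ^ (d + 1))⁻¹ : ℝ) : ℂ) := by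
    push_cast
    rfl
  simp only [Matrix.mul_apply, QGRe_apply, KRe, qggqRe, Matrix.of_apply, qggq, hc]
  rw [sum_box_eq_sum_idx (fun i => n * N i), Complex.re_ofReal_mul, Complex.re_sum, Finset.mul_sum]
  refine Finset.sum_congr rfl fun z _ => ?_
  rw [Complex.mul_re, Complex.conj_re, Complex.conj_im, KT_im n hn1 a 0 ha le_rfl hN, KT_im n hn1 a 0 ha le_rfl hN]
  ring

/-- **THE SHAPE `B * G * G * Bst` OF `B5Decay126.decay126_torus` WITH `B := QGRe`, `G := 1`, `Bst := KRe`**: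
`QGRe · 1 · 1 · KRe = qggqRe` — in the multiplier model the coercive product of the (1.126) engine is met WITHOUT a
separate matrix for `G′` (the Green operator is absorbed into the two factors `Q′G′`, `G′Q′^*`, exactly as it occurs in
`P = G′Q′^*(Q′G′²Q′^*)^{−1}Q′G′`). [folklore] -/
theorem QGRe_one_one_KRe (n : ℕ) [NeZero n] (hn1 : 1 ≤ n) (a : ℝ) (ha : 0 < a) {N : Fin (d + 1) → ℕ}
    (hN : ∀ i, 1 ≤ N i) :
    QGRe n a N * (1 : Matrix (Idx (fun i => n * N i)) (Idx (fun i => n * N i)) ℝ)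
        * (1 : Matrix (Idx (fun i => n * N i)) (Idx (fun i => n * N i)) ℝ) * KRe n a N
      = qggqRe n a N := by
  rw [Matrix.mul_one, Matrix.mul_one, QGRe_mul_KRe n hn1 a ha hN]

/-- **HYPOTHESIS `hM : QGQInverse.Coercive (B * G * G * Bst) γ₀` OF `decay126_torus`, DISCHARGED IN THE MULTIPLIER
MODEL** (`B := QGRe`, `G := 1`, `Bst := KRe`): one `γ₀ > 0` for every `n = L^k ≥ 1`, `a ∈ [a₋,a₊]` and every torus
(`B5QGGQ145Bounds.coercive_qggqRe`). [cite: Balaban1984PropagatorsI, p.26 (the sentence after (1.45), `γ₀ ≦ Q′_kG′_k²Q′_k^*`);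
p.38 ((1.126): "They follow from the representation P = G′Q′*(Q′G′²Q′*)⁻¹Q′G′ …")] -/
theorem coercive_factorised (d : ℕ) (aminus aplus : ℝ) (ha : 0 < aminus) :
    ∃ γ₀ : ℝ, 0 < γ₀ ∧ ∀ (n : ℕ) [NeZero n], 1 ≤ n → ∀ a : ℝ, aminus ≤ a → a ≤ aplus →
      ∀ (N : Fin (d + 1) → ℕ), (∀ i, 1 ≤ N i) →
        QGQInverse.Coercive
          (QGRe n a N * (1 : Matrix (Idx (fun i => n * N i)) (Idx (fun i => n * N i)) ℝ)
            * (1 : Matrix (Idx (fun i => n * N i)) (Idx (fun i => n * N i)) ℝ) * KRe n a N) γ₀ := by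
  obtain ⟨γ₀, h0, h⟩ := coercive_qggqRe d aminus aplus ha
  refine ⟨γ₀, h0, fun n _ hn1 a ha1 ha2 N hN => ?_⟩
  rw [QGRe_one_one_KRe n hn1 a (lt_of_lt_of_le ha ha1) hN]
  exact h n hn1 a ha1 ha2 N hN

/-- the inverse of the factorised product is the real inverse kernel `kerRe` (`= Re torusKernel145M`). [folklore] -/
theorem inv_factorised (n : ℕ) [NeZero n] (hn1 : 1 ≤ n) (a : ℝ) (ha : 0 < a) {N : Fin (d + 1) → ℕ}
    (hN : ∀ i, 1 ≤ N i) :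
    (QGRe n a N * (1 : Matrix (Idx (fun i => n * N i)) (Idx (fun i => n * N i)) ℝ)
        * (1 : Matrix (Idx (fun i => n * N i)) (Idx (fun i => n * N i)) ℝ) * KRe n a N)⁻¹
      = kerRe n a N := by
  rw [QGRe_one_one_KRe n hn1 a ha hN, qggqRe_inv n hn1 a ha hN]

/-! ### §4 The entries of the factors decay (b04's Lemma 2.4 on the torus, by name) -/

/-- **THE ENTRIES OF `G′Q′^*` DECAY, UNIFORMLY** — b04's `B4Torus248Decay.kernel248_torusKernel_decay_torusMetric` at
`m² = 0` read on the matrix `KRe` (`K_T(z,y) = torusKernel248 n a 0 (offset z) N (coarse z − y)`, `|Re w| ≤ ‖w‖`): for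
`0 < a₋ ≤ a₊` there are `κ > 0`, `M ≥ 0` with
`|KRe_{n,a,N}(z,k)| ≤ M·periodConst κ d·e^{−(κ/(d+1))·|coarse(z) − k|_{T₁}}` for every `n ≥ 1` (`NeZero`), `a ∈ [a₋,a₊]`,
`N` (`N_μ ≥ 1`), `z`, `k`; `|·|_{T₁} = MultiPeriod.torusSupNorm N`, the sup-distance of the unit torus.
[cite: Balaban1983RegularityDecay, Lemma 2.4 (2.35) p.582, (2.48); Balaban1984PropagatorsI, p.38 "from Lemma 2.4 of [2]"] -/
theorem KRe_decay (d : ℕ) (aminus aplus : ℝ) (ha : 0 < aminus) :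
    ∃ κ M : ℝ, 0 < κ ∧ 0 ≤ M ∧ ∀ (n : ℕ) [NeZero n] (a : ℝ), aminus ≤ a → a ≤ aplus →
      ∀ (N : Fin (d + 1) → ℕ), (∀ i, 1 ≤ N i) → ∀ (z : Idx (fun i => n * N i)) (k : Idx N),
        |KRe n a N z k| ≤ M * periodConst κ d *
          Real.exp (-(κ / (d + 1) * MultiPeriod.torusSupNorm N (coarse n (toZ z) - toZ k))) := by
  obtain ⟨κ, M, hκ, hM, h⟩ := kernel248_torusKernel_decay_torusMetric d aminus aplus 0 ha
  refine ⟨κ, M, hκ, hM, fun n _ a ha1 ha2 N hN z k => ?_⟩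
  calc |KRe n a N z k| = |(KT n a 0 N (toZ z) (toZ k)).re| := rfl
    _ ≤ ‖KT n a 0 N (toZ z) (toZ k)‖ := Complex.abs_re_le_norm _
    _ ≤ M * periodConst κ d * Real.exp (-(κ / (d + 1) * MultiPeriod.torusSupNorm N (coarse n (toZ z) - toZ k))) :=
        h n a 0 ha1 ha2 le_rfl le_rfl (offset n (toZ z)) N hN (coarse n (toZ z) - toZ k)

/-- the entries of `Q′G′` are those of `G′Q′^*` transposed and scaled by `ξ^{d+1} ≤ 1`. [folklore] -/
theorem abs_QGRe_le (n : ℕ) [NeZero n] (hn1 : 1 ≤ n) (a : ℝ) (N : Fin (d + 1) → ℕ) (k : Idx N)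
    (z : Idx (fun i => n * N i)) : |QGRe n a N k z| ≤ |KRe n a N z k| := by
  rw [QGRe_apply, abs_mul, abs_inv, abs_pow, Nat.abs_cast]
  have h1 : (1 : ℝ) ≤ (n : ℝ) ^ (d + 1) := one_le_pow₀ (by exact_mod_cast hn1)
  calc ((n : ℝ) ^ (d + 1))⁻¹ * |KRe n a N z k| ≤ 1 * |KRe n a N z k| :=
        mul_le_mul_of_nonneg_right (inv_le_one_of_one_le₀ h1) (abs_nonneg _)
    _ = |KRe n a N z k| := one_mul _

/-- **THE ENTRIES OF `Q′G′` DECAY, UNIFORMLY** (same constants as `KRe_decay`). [folklore] -/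
theorem QGRe_decay (d : ℕ) (aminus aplus : ℝ) (ha : 0 < aminus) :
    ∃ κ M : ℝ, 0 < κ ∧ 0 ≤ M ∧ ∀ (n : ℕ) [NeZero n], 1 ≤ n → ∀ a : ℝ, aminus ≤ a → a ≤ aplus →
      ∀ (N : Fin (d + 1) → ℕ), (∀ i, 1 ≤ N i) → ∀ (k : Idx N) (z : Idx (fun i => n * N i)),
        |QGRe n a N k z| ≤ M * periodConst κ d *
          Real.exp (-(κ / (d + 1) * MultiPeriod.torusSupNorm N (coarse n (toZ z) - toZ k))) := by
  obtain ⟨κ, M, hκ, hM, h⟩ := KRe_decay d aminus aplus ha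
  exact ⟨κ, M, hκ, hM, fun n _ hn1 a ha1 ha2 N hN k z =>
    (abs_QGRe_le n hn1 a N k z).trans (h n a ha1 ha2 N hN z k)⟩

end

end Literature.MathematicalPhysics.QuantumFieldTheory.Balaban1983to89.B5QGGQ145Factor
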